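import Literature.NumberTheory.ComplexMultiplication.EllipticUnits.ImaginaryQuadraticMainConjectureLayerDualityMaps
import Literature.NumberTheory.GaloisCohomology.PoitouTateShaRestrictedLayers
import HarnessLib

/-!
# The class-group row of Johnson-Leung–Kings 2011, Lemma 5.8 — the LAYER PAIRINGS of the ROW 1 socket:
# Poitou–Tate `Ш²_S(K̃_n, μ_{p^k} ⊗ θ′) × Ш¹_S(K̃_n, (ℤ/p^k)(θ)) → ℚ/ℤ` in the carrier's currency, PERFECT
# (from the base-field named fact `poitouTate_shaRestricted_tateDual_natural_at`, displayed)

Topic `Literature/NumberTheory/ComplexMultiplication/EllipticUnits` (grouping sub-namespace `JohnsonLeungKings2011.ClassGroupRow`).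
Cell `bsd-print-cf2` (`run/shared/lean/pub/bsd-print-cf2/`), width seat `bsd-line-cf2c-w8` g8 (prover): the `pair` /
`pair_bijective` fields of the socket `JohnsonLeungKings2011.LayerDuality` (`ImaginaryQuadraticMainConjectureClassGroupRow.lean`),
assembled BY NAME from the layer Poitou–Tate pairing of the tree (`PoitouTateShaRestrictedLayers.exists_shaRestricted_pairing_coind_of
_natural_at`, seat cf2c-w8 g7: the pairing `P` of the coinduced modules with (P_V) perfectness and (N_V) naturality, from the displayed
base-field fact `h`), the Ш-condition transports `ShaLayer.shaRestrictedCoindLayerEquiv_one/_two` (seat cf2c-w3 g9) and the coefficient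
data `muZModPairing` / `zmodTwist` (`…TorsionCoefficients`). Definitions with bodies (`shaPairing`, `eTwo`, `eOne`, `pair`) and theorems;
NO named fact (the Poitou–Tate fact is a displayed HYPOTHESIS `h`), no instance, no `sorry`.

* §1 (a `Fintype (Γ_K ⧸ V_n)` structure is a section hypothesis `hFin`, any choice) the hypotheses of (P_V) for `M = μ_{p^k}`:
  `mu_torsion`, `natCard_mu_mem`, and `shaPairing h hθ n k` — the tree's `P` at
  `(μ_{p^k} ⊗ θ′, (ℤ/p^k)(unitChar θ), B = muZModPairing, V_n)` (equivariance `muZModPairing_equivariant` needs `θ′·unitChar θ = 1`).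
* §2 **`pair h hθ hV hμ hZ n k : Ш²_S(K̃_n, μ_{p^k} ⊗ θ′) →+ (Ш¹_S(K̃_n, (ℤ/p^k)(θ)) →+ ℚ/ℤ)`** in the LAYER currency (transport
  of `shaPairing` along `shaRestrictedCoindLayerEquiv_two/_one`), `pair_apply`, and **`pair_bijective`** (perfectness: (P_V) with
  `bijective_muZModPairing_flip`, `isUnramifiedOutside_coindOpen`, `natCard_mu_mem`).
The naturalities `pair_cores / pair_red / pair_conj` ((N_V) with the adjoint pairs trace ⊣ pull-back, `ζ ↦ ζ^p` ⊣ `a ↦ p·a`,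
`R_γ ⊣ R_{γ⁻¹}`, read through cf2c-w3 g10's dictionary) and the `LayerDuality` term are the sequel.

HONEST FRAMING: bookkeeping over a displayed named fact; no case of Poitou–Tate duality, of the main conjecture or of BSD is
proved here; no summit statement is proved by this seat.

## References
* J. S. Milne, *Arithmetic Duality Theorems* (2006), I Thm. 4.10 (a) (p. 57), §4 p. 65. [MilneADT2006]
* J. Johnson-Leung, G. Kings, J. reine angew. Math. 653 (2011), §5.4 Lemma 5.8 (arXiv p0015:L150–165). [JohnsonLeungKings2011]
* D. Harari, *Galois Cohomology and Class Field Theory* (2020), Thm. 17.13 (b). [Harari2020]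
-/

noncomputable section

open scoped NumberField
open CategoryTheory Field IsDedekindDomain
open Literature.NumberTheory.GaloisRepresentations
open Literature.NumberTheory.GaloisRepresentations.DiscreteGaloisModule
open Literature.NumberTheory.GaloisCohomology Literature.NumberTheory.GaloisCohomology.ShaLayer
open Literature.NumberTheory.EllipticCurves Literature.NumberTheory.EllipticCurves.KellerYin2024

namespace Literature.NumberTheory.ComplexMultiplication.EllipticUnits.JohnsonLeungKings2011.ClassGroupRow

variable {K : Type} [Field K] [NumberField K] (p : ℕ) [Fact p.Prime]
  (κ₁ κ₂ : ZpExtension K p) (θ : FramedGaloisRep K (padicCoeffIntegers (∅ : Set (PadicAlgCl p))) 1)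
  (θ' : absoluteGaloisGroup K →ₜ* ℤ_[p]ˣ) (𝔣 : Ideal (𝓞 K))
  [hFin : ∀ n : ℕ, Fintype (absoluteGaloisGroup K ⧸ pairLayerSubgroup κ₁ κ₂ n)]

/-! ## §1 The layer pairing in `Ш`-currency -/

omit [NumberField K] [Fact p.Prime] in
/-- `μ_{p^k}` is killed by `p^k`. [cite: MilneADT2006, I Thm. 4.10 (a) (p. 57)] -/
theorem mu_torsion (k : ℕ) (m : MuCarrier K (p ^ k)) : p ^ k • m = 0 := by
  apply muVal_injective K (p ^ k)
  rw [muVal_nsmul, muVal_pow_eq_one, muVal_zero]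

/-- **"the order of `μ_{p^k}` is a unit outside `S = supp(p𝔣)`"** (`#μ_{p^k}(K̄) = p^k`, characteristic `0`).
[cite: MilneADT2006, I Thm. 4.10 (a) (p. 57)] [cite: JohnsonLeungKings2011, Cor. 5.3 (arXiv p0015:L1–3)] -/
theorem natCard_mu_mem (k : ℕ) (v : HeightOneSpectrum (𝓞 K))
    (hv : ((Nat.card (MuCarrier K (p ^ k)) : ℕ) : 𝓞 K) ∈ v.asIdeal) : v ∈ suppPF p 𝔣 := by
  haveI : NeZero ((p ^ k : ℕ) : AlgebraicClosure K) := ⟨Nat.cast_ne_zero.2 (NeZero.ne (p ^ k))⟩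
  have hcard : Nat.card (MuCarrier K (p ^ k)) = p ^ k := HasEnoughRootsOfUnity.natCard_rootsOfUnity (AlgebraicClosure K) (p ^ k)
  rw [hcard, Nat.cast_pow] at hv
  exact mem_suppPF_of_mem p 𝔣 v (v.isPrime.mem_of_pow_mem _ hv)

variable (h : poitouTate_shaRestricted_tateDual_natural_at K (suppPF p 𝔣))
  (hθ : ∀ σ : absoluteGaloisGroup K, ((θ' σ : ℤ_[p]ˣ) : ℤ_[p]) * ((unitChar θ σ : ℤ_[p]ˣ) : ℤ_[p]) = 1)

/-- **The Poitou–Tate pairing of the layer `(n, k)` in `Ш`-currency**: the tree's pairing `P` (from the displayed base-field fact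
`h`) at `M = μ_{p^k} ⊗ θ′`, `M′ = (ℤ/p^k)(unitChar θ)`, `B = muZModPairing` (equivariant since `θ′·unitChar θ = 1`), `V = V_n`:
`Ш²_S(K, Ind_{V_n} M) × Ш¹_S(K, Ind_{V_n} M′) → ℚ/ℤ`. [cite: MilneADT2006, I Thm. 4.10 (a) (p. 57)] [cite: Harari2020, Thm. 17.13 (b)] -/
def shaPairing (n k : ℕ) :
    ↥(shaRestricted ((muTwist p θ' k).coind (pairLayerSubgroup κ₁ κ₂ n) (isOpen_pairLayerSubgroup κ₁ κ₂ n)) (suppPF p 𝔣) 2) →+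
      ↥(shaRestricted ((zmodTwist p (unitChar θ) k).coind (pairLayerSubgroup κ₁ κ₂ n) (isOpen_pairLayerSubgroup κ₁ κ₂ n))
        (suppPF p 𝔣) 1) →+ AddCircle (1 : ℚ) :=
  Classical.choose (exists_shaRestricted_pairing_coind_of_natural_at (suppPF p 𝔣) h) (p ^ k) (MuCarrier K (p ^ k))
    (ZMod (p ^ k)) (muTwist p θ' k) (zmodTwist p (unitChar θ) k) (muZModPairing K p k)
    (muZModPairing_equivariant K p k (unitChar θ) θ' hθ) (pairLayerSubgroup κ₁ κ₂ n) (isOpen_pairLayerSubgroup κ₁ κ₂ n)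

variable (hV : ∀ n : ℕ, ramificationSubgroup K (suppPF p 𝔣) ≤ pairLayerSubgroup κ₁ κ₂ n)
  (hμ : ∀ k : ℕ, ramificationSubgroup K (suppPF p 𝔣) ≤ ContinuousRep.ker (muTwist p θ' k))
  (hZ : ∀ k : ℕ, ramificationSubgroup K (suppPF p 𝔣) ≤ ContinuousRep.ker (zmodTwist p (unitChar θ) k))

include hV hμ in
/-- **PERFECTNESS in `Ш`-currency** ((P_V) of the tree's pairing: `p^k ≥ 1`, `μ_{p^k}` is `p^k`-torsion, `Ind_{V_n}(μ_{p^k} ⊗ θ′)` is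
unramified outside `S` (`isUnramifiedOutside_coindOpen`), `#μ_{p^k}` is a unit outside `S`, and `a ↦ B(·, a)` is bijective
(`bijective_muZModPairing_flip`)). [cite: MilneADT2006, I Thm. 4.10 (a) (p. 57)] [cite: Harari2020, Thm. 17.13 (b)] -/
theorem shaPairing_bijective (n k : ℕ) :
    Function.Bijective (shaPairing p κ₁ κ₂ θ θ' 𝔣 h hθ n k) ∧ Function.Bijective (shaPairing p κ₁ κ₂ θ θ' 𝔣 h hθ n k).flip := by
  haveI := finiteIndex_pairLayerSubgroup p κ₁ κ₂ n
  haveI : NeZero (p ^ k) := ⟨pow_ne_zero k (Fact.out : p.Prime).ne_zero⟩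
  have hur : GaloisRep.IsUnramifiedOutside (suppPF p 𝔣)
      ((muTwist p θ' k).coind (pairLayerSubgroup κ₁ κ₂ n) (isOpen_pairLayerSubgroup κ₁ κ₂ n)) :=
    isUnramifiedOutside_coindOpen (suppPF p 𝔣) (muTwist p θ' k) (pairLayerSubgroup κ₁ κ₂ n)
      (isOpen_pairLayerSubgroup κ₁ κ₂ n) (hV n) (hμ k)
  obtain ⟨-, -, hb, hbf⟩ := (Classical.choose_spec (exists_shaRestricted_pairing_coind_of_natural_at (suppPF p 𝔣) h)).1
    (p ^ k) (MuCarrier K (p ^ k)) (ZMod (p ^ k)) (muTwist p θ' k) (zmodTwist p (unitChar θ) k) (muZModPairing K p k)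
    (muZModPairing_equivariant K p k (unitChar θ) θ' hθ) (pairLayerSubgroup κ₁ κ₂ n) (isOpen_pairLayerSubgroup κ₁ κ₂ n)
    (bijective_muZModPairing_flip K p k) (mu_torsion p k) hur (natCard_mu_mem p 𝔣 k)
  exact ⟨hb, hbf⟩

/-! ## §2 The layer pairing in the carrier's currency -/

/-- The Ш-transport for `Ш²_S(K̃_n, μ_{p^k} ⊗ θ′)` (cf2c-w3 g9's `shaRestrictedCoindLayerEquiv_two` at `V_n`).
[cite: MilneADT2006, I §4 (p. 56)] -/
def eTwo (n k : ℕ) :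
    ↥(shaRestricted ((muTwist p θ' k).coind (pairLayerSubgroup κ₁ κ₂ n) (isOpen_pairLayerSubgroup κ₁ κ₂ n)) (suppPF p 𝔣) 2) ≃+
      ↥(layerShaRestricted (suppPF p 𝔣) (muTwist p θ' k) (pairLayerSubgroup κ₁ κ₂ n) 2) :=
  shaRestrictedCoindLayerEquiv_two (suppPF p 𝔣) (muTwist p θ' k) (pairLayerSubgroup κ₁ κ₂ n)
    (isOpen_pairLayerSubgroup κ₁ κ₂ n) (hV n) (hμ k)

/-- The Ш-transport for `Ш¹_S(K̃_n, (ℤ/p^k)(θ))` (`shaRestrictedCoindLayerEquiv_one` at `V_n`). [cite: MilneADT2006, I §4 (p. 56)] -/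
def eOne (n k : ℕ) :
    ↥(shaRestricted ((zmodTwist p (unitChar θ) k).coind (pairLayerSubgroup κ₁ κ₂ n) (isOpen_pairLayerSubgroup κ₁ κ₂ n))
        (suppPF p 𝔣) 1) ≃+ ↥(shaOne p κ₁ κ₂ θ 𝔣 n k) :=
  shaRestrictedCoindLayerEquiv_one (suppPF p 𝔣) (zmodTwist p (unitChar θ) k) (pairLayerSubgroup κ₁ κ₂ n)
    (isOpen_pairLayerSubgroup κ₁ κ₂ n) (hV n) (hZ k)

/-- **THE LAYER PAIRING `pair n k : Ш²_S(K̃_n, μ_{p^k} ⊗ θ′) →+ (Ш¹_S(K̃_n, (ℤ/p^k)(θ)) →+ ℚ/ℤ)`** in the currency of the socket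
(`Sha n k ≤ layerCoh … 2`, `Y n k = shaOne …`): `pair y z = P (e₂⁻¹ y) (e₁⁻¹ z)`.
[cite: MilneADT2006, I Thm. 4.10 (a) (p. 57)] [cite: JohnsonLeungKings2011, §5.4 Lemma 5.8 (arXiv p0015:L150–165)] -/
def pair (n k : ℕ) :
    ↥(layerShaRestricted (suppPF p 𝔣) (muTwist p θ' k) (pairLayerSubgroup κ₁ κ₂ n) 2) →+
      (↥(shaOne p κ₁ κ₂ θ 𝔣 n k) →+ AddCircle (1 : ℚ)) :=
  ((AddMonoidHom.compHom.flip (eOne p κ₁ κ₂ θ 𝔣 hV hZ n k).symm.toAddMonoidHom).comp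
      (shaPairing p κ₁ κ₂ θ θ' 𝔣 h hθ n k)).comp
    (eTwo p κ₁ κ₂ θ' 𝔣 hV hμ n k).symm.toAddMonoidHom

set_option maxHeartbeats 1600000 in
/-- Values of `pair`. [cite: MilneADT2006, I Thm. 4.10 (a) (p. 57)] -/
theorem pair_apply (n k : ℕ) (y : layerShaRestricted (suppPF p 𝔣) (muTwist p θ' k) (pairLayerSubgroup κ₁ κ₂ n) 2)
    (z : shaOne p κ₁ κ₂ θ 𝔣 n k) :
    pair p κ₁ κ₂ θ θ' 𝔣 h hθ hV hμ hZ n k y z =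
      shaPairing p κ₁ κ₂ θ θ' 𝔣 h hθ n k ((eTwo p κ₁ κ₂ θ' 𝔣 hV hμ n k).symm y) ((eOne p κ₁ κ₂ θ 𝔣 hV hZ n k).symm z) := rfl

set_option maxHeartbeats 1600000 in
/-- **PERFECTNESS of the layer pairing**: `y ↦ pair y` is a bijection `Ш²_S(K̃_n, μ_{p^k} ⊗ θ′) ≅ Hom(Ш¹_S(K̃_n, (ℤ/p^k)(θ)), ℚ/ℤ)`
(transport of `shaPairing_bijective` along the two Ш-equivalences) — the field `pair_bijective` of the socket.
[cite: MilneADT2006, I Thm. 4.10 (a) (p. 57)] [cite: Harari2020, Thm. 17.13 (b)] -/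
theorem pair_bijective (n k : ℕ) : Function.Bijective (pair p κ₁ κ₂ θ θ' 𝔣 h hθ hV hμ hZ n k) := by
  obtain ⟨hb, -⟩ := shaPairing_bijective p κ₁ κ₂ θ θ' 𝔣 h hθ hV hμ n k
  constructor
  · intro y y' hyy'
    have h1 : shaPairing p κ₁ κ₂ θ θ' 𝔣 h hθ n k ((eTwo p κ₁ κ₂ θ' 𝔣 hV hμ n k).symm y) =
        shaPairing p κ₁ κ₂ θ θ' 𝔣 h hθ n k ((eTwo p κ₁ κ₂ θ' 𝔣 hV hμ n k).symm y') := by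
      ext c
      have h2 := DFunLike.congr_fun hyy' (eOne p κ₁ κ₂ θ 𝔣 hV hZ n k c)
      rw [pair_apply, pair_apply, AddEquiv.symm_apply_apply] at h2
      exact h2
    exact (eTwo p κ₁ κ₂ θ' 𝔣 hV hμ n k).symm.injective (hb.1 h1)
  · intro χ
    obtain ⟨x, hx⟩ := hb.2 (χ.comp (eOne p κ₁ κ₂ θ 𝔣 hV hZ n k).toAddMonoidHom)
    refine ⟨eTwo p κ₁ κ₂ θ' 𝔣 hV hμ n k x, AddMonoidHom.ext fun z => ?_⟩
    rw [pair_apply, AddEquiv.symm_apply_apply, hx, AddMonoidHom.comp_apply]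
    exact congrArg χ ((eOne p κ₁ κ₂ θ 𝔣 hV hZ n k).apply_symm_apply z)

end Literature.NumberTheory.ComplexMultiplication.EllipticUnits.JohnsonLeungKings2011.ClassGroupRow

end
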